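import Literature.Probability.Percolation.VerticalTransportProcess
import HarnessLib

/-!
# Transport of vertical crossings (GM14 Proposition 6.8) — III: the record survives a critical
# exchange with probability at least `θ(ε)` (GM14 (6.34))

Grimmett–Manolescu, *Bond percolation on isoradial graphs* (PTRF 159 (2014) 273–327 =
arXiv:1204.0505), §6.3, (6.34): "`P(h^k_{j+1} ≥ h | h^k_j = h) ≥ 2δ` if `h = j + 1`", proved through
the optimal path `Γ`: "`{Γ(ω^k_j) = γ} = {γ is ω^k_j-open} ∩ N_γ` […] `P(C_F | Γ = γ) ≥ P^k_j(C_F)`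
(6.36) […] By studying the three relevant star–triangle transformations contributing to `Σ_j` […]
`P(h(Σ_j(γ)) ≥ j | Γ = γ) ≥ p_{e₁}p_{e₄}/((1-p_{e₁})(1-p_{e₄})) · P(C_F | Γ = γ)`. In summary,
`P(h^k_{j+1} ≥ h^k_j | Γ = γ) ≥ p_{e₁}p_{e₄}(1-p_{e₂})(1-p_{e₃}) ≥ p_{π-ε}⁴ = 2δ` (6.37)."

This file proves the corresponding inequality for the process of `VerticalTransportProcess`, in
the unconditional form consumed by the tail bound of `ChainTailBound`:

* **`VData.theta_mul_measureReal_le`** — for every exchange `t < N²` of level `ℓ`,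
  `θ · P(G t = ℓ) ≤ P(G t = ℓ ∧ G (t+1) ≥ ℓ)` with `θ = ½ sin³(ε/3)` (`VData.θ`; the printed
  `2δ = p_{π-ε}⁴`, here with the single closed edge `e₃` of `TrackExchangeTop` and cruder
  trigonometric bounds).

Proof (as printed, with the bookkeeping of this formalization): by the pair law the statement is
about `P_t ⊗ ν`; `{h = ℓ}` is partitioned, up to the null set of unclean configurations, by the
events `Eopt ℓ γ = {Γ = γ}` (`OptimalWitness`); for each `γ` the product of
`Eopt ℓ γ ∩ {critEdge closed}` with the favourable set of the designated uniform variable is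
contained in `{h = ℓ, h' ≥ ℓ}` (the deterministic statement `hRec_sweep₂_ge_of_topWit` of
`VerticalSweepTwoSided`), and has probability at least
`(1 - p_{e₃}) · vol(critU) · P(Eopt ℓ γ) ≥ θ · P(Eopt ℓ γ)` by (6.36) (`le_measure_notMem_inter_Eopt`,
Harris) and `le_volume_critU`; summing over `γ` gives the claim.

## References

* G. R. Grimmett, I. Manolescu, PTRF 159 (2014) 273–327, arXiv:1204.0505, §6.3 (6.34)–(6.37).
-/

noncomputable section

namespace Literature.Probability.Percolation

open LatticeModels StarTriangle Real MeasureTheory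

namespace TrackExchange

/-! ### The last two vertices of a walk, as functions -/

/-- The column of the last vertex of a walk (`0` if none). [folklore] -/
def lastCol (γ : List SV) : ℤ := match γ.getLast? with
  | some (some b) => b.1
  | _ => 0

/-- The column of the last-but-one vertex of a walk (`0` if none). [folklore] -/
def prevCol (γ : List SV) : ℤ := match γ.dropLast.getLast? with
  | some (some a) => a.1
  | _ => 0

/-- `lastCol` on a walk with a known last vertex. [folklore] -/
theorem lastCol_eq {γ : List SV} {b : ℤ × ℤ} (h : γ.getLast? = some (some b)) : lastCol γ = b.1 := by
  unfold lastCol; rw [h]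

/-- `prevCol` on a walk with a known last-but-one vertex. [folklore] -/
theorem prevCol_eq {γ : List SV} {a : ℤ × ℤ} (h : γ.dropLast.getLast? = some (some a)) : prevCol γ = a.1 := by
  unfold prevCol; rw [h]

/-- A vertex of a list is in `dropLast` or is the last one. [folklore] -/
theorem mem_dropLast_or_getLast {γ : List SV} {v : SV} (hv : v ∈ γ) : v ∈ γ.dropLast ∨ γ.getLast? = some v := by
  have hne : γ ≠ [] := by rintro rfl; simp at hv
  obtain ⟨ys, w, rfl⟩ : ∃ ys w, γ = ys ++ [w] := ⟨γ.dropLast, γ.getLast hne, (List.dropLast_append_getLast hne).symm⟩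
  rw [List.mem_append, List.mem_singleton] at hv
  rcases hv with hv | rfl
  · left; rw [List.dropLast_concat]; exact hv
  · right; simp

/-- **The designated edge is not an edge of a top witness**: it has an endpoint of top height in
another column, while the top is the only vertex of the witness at top height. [folklore] -/
theorem critEdge_notMem_edgesOf {D : ExchangeData} {S : Set (ℤ × ℤ)} {ω : Set (Sym2 SV)} {γ : List SV} {x : ℤ}
    (hW : TopWit S ω D.j γ) (hb : γ.getLast? = some (some (x, D.j))) : D.critEdge x ∉ edgesOf γ := by
  intro he
  obtain ⟨m, hmx, hm⟩ := ExchangeData.critEdge_eq (D := D) x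
  obtain ⟨p, q, hpq, hepq⟩ := exists_infix_of_mem_edgesOf he
  rw [hepq] at hm
  have hv : (some (m, D.j) : SV) ∈ γ := by
    rcases Sym2.mem_iff.1 hm with h | h
    · rw [h]; exact hpq.subset (by simp)
    · rw [h]; exact hpq.subset (by simp)
  rcases mem_dropLast_or_getLast hv with h | h
  · have := hW.below _ h; simp [lht] at this
  · rw [hb] at h; simp only [Option.some.injEq, Prod.mk.injEq] at h; exact hmx h.1.symm

namespace VData

variable (V : VData)

/-- **The constant `θ(ε) = ½ sin³(ε/3)`**: a lower bound for the conditional probability that the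
record survives a critical exchange (GM14's `2δ = p_{π-ε}⁴`, here from `e₃` alone).
[cite: GrimmettManolescu2014Isoradial, §6.3 (6.37)] -/
def θ (ε : ℝ) : ℝ := Real.sin (ε / 3) / 2 * Real.sin (ε / 3) ^ 2

/-- `0 < θ(ε) ≤ 1` for `0 < ε ≤ π - ε`. [folklore] -/
theorem θ_pos_le {ε : ℝ} (hε : 0 < ε) (hε' : ε ≤ π - ε) : 0 < θ ε ∧ θ ε ≤ 1 := by
  have hs : 0 < Real.sin (ε / 3) := Real.sin_pos_of_pos_of_lt_pi (by linarith) (by linarith)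
  have hs1 : Real.sin (ε / 3) ≤ 1 := Real.sin_le_one _
  unfold θ
  refine ⟨by positivity, ?_⟩
  calc Real.sin (ε / 3) / 2 * Real.sin (ε / 3) ^ 2 ≤ 1 / 2 * 1 := by
        refine mul_le_mul (by linarith) ?_ (by positivity) (by norm_num)
        nlinarith
    _ ≤ 1 := by norm_num

/-! ### The events of the decomposition -/

section Events

variable {V}
variable (t : ℕ)

/-- The level of exchange `t`, as a natural number. [folklore] -/
def ℓN : ℕ := (V.ℓT t).toNat

/-- A walk is *risky* for exchange `t` when it reaches its top from the side on which the top may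
lose height. [cite: GrimmettManolescu2014Isoradial, §6.3] -/
def Risky (γ : List SV) : Prop := prevCol γ = lastCol γ + (V.Dt t).critSide

/-- **The configuration factor** of the product event of `γ`: `Γ = γ` (and record `ℓ`), together
with the designated edge closed when `γ` is risky. [cite: GrimmettManolescu2014Isoradial, §6.3] -/
def Aev (γ : List SV) : Set (Set (Sym2 SV)) :=
  Eopt (V.weightsT t) (V.DomT t) V.N (V.ℓN t) γ ∩ {ω | V.Risky t γ → (V.Dt t).critEdge (lastCol γ) ∉ ω}

/-- **The noise factor** of the product event of `γ`: the designated uniform variable in the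
favourable set when `γ` is risky. [cite: GrimmettManolescu2014Isoradial, §6.3] -/
def Bev (γ : List SV) : Set V.Noise :=
  {r | V.Risky t γ → ∀ t' : Fin (2 * V.M), -(V.M : ℤ) + t' = (V.Dt t).critIdx (lastCol γ) → r.2 t' ∈ (V.Dt t).critU (lastCol γ)}

/-- The target event on (configuration, noise): record `ℓ` now, at least `ℓ` after the exchange. [folklore] -/
def Bset : Set (Set (Sym2 SV) × V.Noise) :=
  {p | hRec (V.DomT t) V.N p.1 = V.ℓN t ∧ V.ℓN t ≤ hRec (V.DomT (t + 1)) V.N (V.stepV t p.1 p.2)}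

/-- `Aev` is measurable. [folklore] -/
theorem measurableSet_Aev (γ : List SV) : MeasurableSet (V.Aev t γ) := by
  unfold Aev
  refine (measurableSet_Eopt _ _ _ _ _).inter ?_
  by_cases h : V.Risky t γ
  · have : {ω : Set (Sym2 SV) | V.Risky t γ → (V.Dt t).critEdge (lastCol γ) ∉ ω} = {ω | (V.Dt t).critEdge (lastCol γ) ∉ ω} := by
      ext ω; simp [h]
    rw [this]; exact measurableSet_notMem _
  · have : {ω : Set (Sym2 SV) | V.Risky t γ → (V.Dt t).critEdge (lastCol γ) ∉ ω} = Set.univ := by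
      ext ω; simp [h]
    rw [this]; exact MeasurableSet.univ

/-- `Bev` is measurable. [folklore] -/
theorem measurableSet_Bev (γ : List SV) : MeasurableSet (V.Bev t γ) := by
  unfold Bev
  by_cases h : V.Risky t γ
  · have : {r : V.Noise | V.Risky t γ → ∀ t' : Fin (2 * V.M), -(V.M : ℤ) + t' = (V.Dt t).critIdx (lastCol γ) →
        r.2 t' ∈ (V.Dt t).critU (lastCol γ)} =
        ⋂ t' : Fin (2 * V.M), {r | -(V.M : ℤ) + t' = (V.Dt t).critIdx (lastCol γ) → r.2 t' ∈ (V.Dt t).critU (lastCol γ)} := by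
      ext r; simp [h]
    rw [this]
    refine MeasurableSet.iInter fun t' => ?_
    by_cases ht' : -(V.M : ℤ) + t' = (V.Dt t).critIdx (lastCol γ)
    · have : {r : V.Noise | -(V.M : ℤ) + t' = (V.Dt t).critIdx (lastCol γ) → r.2 t' ∈ (V.Dt t).critU (lastCol γ)} =
          (fun r : V.Noise => r.2 t') ⁻¹' (V.Dt t).critU (lastCol γ) := by
        ext r; simp [ht']
      rw [this]
      exact ((measurable_pi_apply t').comp measurable_snd) ((V.Dt t).measurableSet_critU _)
    · have : {r : V.Noise | -(V.M : ℤ) + t' = (V.Dt t).critIdx (lastCol γ) → r.2 t' ∈ (V.Dt t).critU (lastCol γ)} = Set.univ := by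
        ext r; simp [ht']
      rw [this]; exact MeasurableSet.univ
  · have : {r : V.Noise | V.Risky t γ → ∀ t' : Fin (2 * V.M), -(V.M : ℤ) + t' = (V.Dt t).critIdx (lastCol γ) →
        r.2 t' ∈ (V.Dt t).critU (lastCol γ)} = Set.univ := by
      ext r; simp [h]
    rw [this]; exact MeasurableSet.univ

/-- `Bset` is measurable. [folklore] -/
theorem measurableSet_Bset : MeasurableSet (V.Bset t) := by
  unfold Bset
  refine MeasurableSet.inter ?_ ?_
  · exact (measurable_hRec _ _).comp measurable_fst (measurableSet_singleton _)
  · exact measurableSet_le measurable_const ((measurable_hRec _ _).comp (V.measurable_stepV t))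

/-- The product events are pairwise disjoint in `γ`. [folklore] -/
theorem disjoint_Aev_prod_Bev (hℓ : V.ℓN t ≤ V.N) :
    Pairwise fun γ γ' : List SV => Disjoint (V.Aev t γ ×ˢ V.Bev t γ) (V.Aev t γ' ×ˢ V.Bev t γ') := by
  intro γ γ' hne
  have hd : Disjoint (Eopt (V.weightsT t) (V.DomT t) V.N (V.ℓN t) γ) (Eopt (V.weightsT t) (V.DomT t) V.N (V.ℓN t) γ') :=
    disjoint_Eopt (M := V.M) (Θ := fun i y => V.rowV (t / V.N) (t % V.N) y - V.α i)
      (S := V.DomT t) (N := V.N) ⟨0, V.zero_mem_DomT t⟩ hℓ hne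
  rw [Set.disjoint_left] at hd ⊢
  rintro ⟨ω, r⟩ ⟨h1, -⟩ ⟨h2, -⟩
  exact hd h1.1 h2.1

end Events

/-! ### The product events are favourable -/

variable {V}

/-- **The product event of `γ` is contained in `{h = ℓ, h' ≥ ℓ}`** (the deterministic statement
`hRec_sweep₂_ge_of_topWit` for the witness `γ`). [cite: GrimmettManolescu2014Isoradial, §6.3 (6.34)] -/
theorem Aev_prod_Bev_subset {ε : ℝ} (hV : V.Valid ε) (hM : 4 * V.N + 4 ≤ V.M) {t : ℕ} (ht : t < V.N * V.N)
    (hℓ : V.ℓN t ≤ V.N) (γ : List SV) : V.Aev t γ ×ˢ V.Bev t γ ⊆ V.Bset t := by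
  rintro ⟨ω, r⟩ ⟨⟨hE, hedge⟩, hr⟩
  have hS0 : ∃ m : ℤ, (m, (0 : ℤ)) ∈ V.DomT t := ⟨0, V.zero_mem_DomT t⟩
  have hmem := (mem_Eopt_iff (M := V.M) (Θ := fun i y => V.rowV (t / V.N) (t % V.N) y - V.α i) hS0 hℓ γ ω).1 hE
  obtain ⟨hclean, hrec, -⟩ := hmem
  obtain ⟨hW, -⟩ := topWit_of_mem_Eopt hE
  refine ⟨hrec, ?_⟩
  -- the level, the constants
  have hℓ1 := one_le_ℓT (V := V) ht
  have hℓeq : ((V.ℓN t : ℕ) : ℤ) = V.ℓT t := by unfold ℓN; exact Int.toNat_of_nonneg (by omega)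
  have hW' : TopWit (Dom (V.cT t) (V.ℓT t)) ω (V.ℓT t) γ := by
    have h := hW; rw [hℓeq] at h; exact h
  obtain ⟨a, b, ha, hb, hby, hay, hadj⟩ := hW'.exists_dropLast_getLast hclean (by omega)
  have hbx : b = (b.1, V.ℓT t) := Prod.ext rfl hby
  rw [hbx] at hb
  have hc0 : 0 ≤ V.cT t := by unfold cT; positivity
  have hcT := cT_le (V := V) ht.le
  have hwide : V.cT t + V.N + 4 ≤ ((V.Dt t).M : ℤ) := by show V.cT t + V.N + 4 ≤ (V.M : ℤ); omega
  have hjN : V.ℓT t ≤ V.N := by rw [← hℓeq]; exact_mod_cast hℓ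
  have key := ExchangeData.hRec_sweep₂_ge_of_topWit (D := V.Dt t) (Dt_valid₂ hV t) hclean (c := V.cT t) (N := V.N)
    hc0 hwide hℓ1 hjN hW' ha hb r ?_
  · -- the record after the exchange is taken in a larger trapezium
    have hmono : hRec (Dom (V.cT t) (V.ℓT t + 1)) V.N ((V.Dt t).sweep₂ ω r) ≤ hRec (V.DomT (t + 1)) V.N (V.stepV t ω r) := by
      refine hRec_mono (Dom_succ_subset_DomT (V := V) ht) (reaches_zero (m := 0) ⟨le_rfl, ?_⟩)
      simp only [abs_zero]; split_ifs <;> omega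
    have h1 : V.ℓT t ≤ (hRec (V.DomT (t + 1)) V.N (V.stepV t ω r) : ℤ) := key.trans (Int.ofNat_le.2 hmono)
    rw [← hℓeq] at h1
    exact_mod_cast h1
  · -- the favourable conditions, from the two factors of the product event
    intro hside
    have hlast : lastCol γ = b.1 := by have := lastCol_eq hb; simpa using this
    have hprev : prevCol γ = a.1 := prevCol_eq ha
    have hrisky : V.Risky t γ := by unfold Risky; rw [hprev, hlast]; exact hside
    refine ⟨?_, fun t' ht' => ?_⟩
    · have := hedge hrisky; rwa [hlast] at this
    · have := hr hrisky t' (by rw [hlast]; exact ht'); rwa [hlast] at this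

/-! ### The product events are likely -/

/-- A nonempty `Eopt ℓ γ` pins down the last two vertices of `γ`, the parity of its top and its
column range. [folklore] -/
theorem shape_of_nonempty_Eopt (hM : 4 * V.N + 4 ≤ V.M) {t : ℕ} (ht : t < V.N * V.N)
    (hℓ : V.ℓN t ≤ V.N) {γ : List SV} (hne : (Eopt (V.weightsT t) (V.DomT t) V.N (V.ℓN t) γ).Nonempty) :
    ∃ (ω : Set (Sym2 SV)) (a : ℤ × ℤ) (x : ℤ), TopWit (V.DomT t) ω (V.ℓT t) γ ∧
      γ.dropLast.getLast? = some (some a) ∧ γ.getLast? = some (some (x, V.ℓT t)) ∧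
      (a.1 = x + 1 ∨ a.1 = x - 1) ∧ Even (x + V.ℓT t) ∧ -(V.M : ℤ) + 2 ≤ x ∧ x + 2 ≤ V.M := by
  obtain ⟨ω, hE⟩ := hne
  obtain ⟨hW, hclean⟩ := topWit_of_mem_Eopt hE
  have hℓ1 := one_le_ℓT (V := V) ht
  have hℓeq : ((V.ℓN t : ℕ) : ℤ) = V.ℓT t := by unfold ℓN; exact Int.toNat_of_nonneg (by omega)
  have hW' : TopWit (V.DomT t) ω (V.ℓT t) γ := by have h := hW; rw [hℓeq] at h; exact h
  obtain ⟨a, b, ha, hb, hby, hay, hadj⟩ := hW'.exists_dropLast_getLast hclean (by omega)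
  have hbx : b = (b.1, V.ℓT t) := Prod.ext rfl hby
  rw [hbx] at hb
  have hjN : V.ℓT t ≤ V.N := by rw [← hℓeq]; exact_mod_cast hℓ
  have hcT := cT_le (V := V) ht.le
  -- column range from the trapezium
  have hxb : -(V.M : ℤ) + 2 ≤ b.1 ∧ b.1 + 2 ≤ V.M := by
    obtain ⟨b', hb', hbD⟩ := hW'.dom _ (List.mem_of_getLast? hb)
    cases hb'
    unfold DomT at hbD
    have h1 := abs_le.1 (abs_le_of_mem_Dom hbD)
    omega
  refine ⟨ω, a, b.1, hW', ha, hb, hadj, ?_, hxb.1, hxb.2⟩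
  -- the top is primal: the last edge is open in a clean configuration
  have hedge : s((some a : SV), some (b.1, V.ℓT t)) ∈ ω := hW'.walk.mem_of_infix (pair_infix_of_getLast? ha hb)
  rw [Sym2.eq_swap] at hedge
  have := even_of_mem_clean hclean hedge
  simpa using this

/-- **The noise factor has probability at least `sin²(ε/3)`** (risky case: the favourable set of
the designated uniform variable; the other coordinates are free). [cite: GrimmettManolescu2014Isoradial, §6.3 (6.37)] -/
theorem le_ν_Bev {ε : ℝ} {t : ℕ} {γ : List SV} {x : ℤ} (hx : lastCol γ = x)
    (hvol : ENNReal.ofReal (Real.sin (ε / 3) ^ 2) ≤ volume ((V.Dt t).critU x)) :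
    ENNReal.ofReal (Real.sin (ε / 3) ^ 2) ≤ V.ν (V.Bev t γ) := by
  have hs1 : ENNReal.ofReal (Real.sin (ε / 3) ^ 2) ≤ 1 := by
    rw [← ENNReal.ofReal_one]; exact ENNReal.ofReal_le_ofReal (by nlinarith [Real.sin_le_one (ε / 3), Real.neg_one_le_sin (ε / 3)])
  by_cases hrisky : V.Risky t γ
  swap
  · have : V.Bev t γ = Set.univ := by ext r; simp [Bev, hrisky]
    rw [this, measure_univ]; exact hs1
  by_cases hidx : ∃ t₀ : Fin (2 * V.M), -(V.M : ℤ) + t₀ = (V.Dt t).critIdx x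
  · obtain ⟨t₀, ht₀⟩ := hidx
    -- the cylinder on the coordinate `t₀` of the second factor
    have hsub : (Set.univ : Set unitInterval) ×ˢ ((fun u : Fin (2 * V.M) → unitInterval => u t₀) ⁻¹' (V.Dt t).critU x) ⊆ V.Bev t γ := by
      rintro ⟨r₁, u⟩ ⟨-, hu⟩ _ t' ht'
      have : t' = t₀ := by apply Fin.ext; rw [hx] at ht'; omega
      subst this
      rw [hx]; exact hu
    refine le_trans ?_ (measure_mono hsub)
    rw [ν, Measure.prod_prod, measure_univ, one_mul, ← Measure.map_apply (measurable_pi_apply t₀) ((V.Dt t).measurableSet_critU x),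
      (measurePreserving_eval (fun _ : Fin (2 * V.M) => (volume : Measure unitInterval)) t₀).map_eq]
    exact hvol
  · have : V.Bev t γ = Set.univ := by
      ext r
      simp only [Bev, Set.mem_setOf_eq, Set.mem_univ, iff_true]
      intro _ t' ht'
      exact absurd ⟨t', by rw [← hx]; exact ht'⟩ hidx
    rw [this, measure_univ]; exact hs1

/-- **Each product event has probability at least `θ · P(Eopt ℓ γ)`** (GM14 (6.36)–(6.37): Harris
for the closed designated edge, the fresh designated uniform variable).
[cite: GrimmettManolescu2014Isoradial, §6.3 (6.36)–(6.37)] -/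
theorem theta_mul_le_Aev_prod_Bev {ε : ℝ} (hV : V.Valid ε) (hM : 4 * V.N + 4 ≤ V.M) {t : ℕ} (ht : t < V.N * V.N)
    (hℓ : V.ℓN t ≤ V.N) (γ : List SV) :
    ENNReal.ofReal (θ ε) * V.μt t (Eopt (V.weightsT t) (V.DomT t) V.N (V.ℓN t) γ) ≤
      V.μt t (V.Aev t γ) * V.ν (V.Bev t γ) := by
  have hε := hV.ε_pos
  have hεπ := hV.ε_lt
  obtain ⟨hθ0, hθ1⟩ := θ_pos_le hε hεπ
  set E := Eopt (V.weightsT t) (V.DomT t) V.N (V.ℓN t) γ with hEdef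
  by_cases hne : E.Nonempty
  swap
  · rw [Set.not_nonempty_iff_eq_empty] at hne
    rw [hne, measure_empty, mul_zero]; exact bot_le
  obtain ⟨ω₀, a, x, hW, ha, hb, hadj, hpar, hx1, hx2⟩ := shape_of_nonempty_Eopt hM ht hℓ hne
  have hlast : lastCol γ = x := lastCol_eq hb
  have hprev : prevCol γ = a.1 := prevCol_eq ha
  by_cases hrisky : V.Risky t γ
  · -- risky: Harris for the closed edge, the designated uniform variable
    have hA : V.Aev t γ = {ω | (V.Dt t).critEdge x ∉ ω} ∩ E := by
      ext ω; simp [Aev, hrisky, hlast, hEdef, and_comm]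
    have hedge := critEdge_notMem_edgesOf (D := V.Dt t) hW hb
    have h1 : ENNReal.ofReal (1 - (V.weightsT t ((V.Dt t).critEdge x) : ℝ)) * V.μt t E ≤ V.μt t (V.Aev t γ) := by
      rw [hA]
      exact le_measure_notMem_inter_Eopt V.M _ (V.DomT t) V.N (V.ℓN t) γ hedge
    have h2 : Real.sin (ε / 3) / 2 ≤ 1 - (V.weightsT t ((V.Dt t).critEdge x) : ℝ) :=
      ExchangeData.half_sin_le_one_sub_critEdge hε (Dt_bac hV t) hpar hx1 hx2
    have hdir : (V.Dt t).lo ≠ (V.Dt t).up := by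
      intro heq
      have h := hrisky
      unfold Risky ExchangeData.critSide at h
      rw [hprev, hlast, if_neg (by rw [heq]; exact lt_irrefl _), if_neg (by rw [heq]; exact lt_irrefl _)] at h
      omega
    have hvolU := ExchangeData.le_volume_critU (Dt_valid₂ hV t) hε (Dt_bac hV t) hpar hx1 hx2 hdir
    have hB := le_ν_Bev (V := V) (t := t) hlast hvolU
    have hs0 : 0 ≤ Real.sin (ε / 3) / 2 :=
      div_nonneg (Real.sin_pos_of_pos_of_lt_pi (by linarith) (by linarith)).le (by norm_num)
    have hθ : ENNReal.ofReal (θ ε) = ENNReal.ofReal (Real.sin (ε / 3) / 2) * ENNReal.ofReal (Real.sin (ε / 3) ^ 2) := by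
      unfold θ; rw [ENNReal.ofReal_mul hs0]
    have h3 : ENNReal.ofReal (Real.sin (ε / 3) / 2) * V.μt t E ≤ V.μt t (V.Aev t γ) :=
      le_trans (mul_le_mul' (ENNReal.ofReal_le_ofReal h2) le_rfl) h1
    calc ENNReal.ofReal (θ ε) * V.μt t E
        = (ENNReal.ofReal (Real.sin (ε / 3) / 2) * V.μt t E) * ENNReal.ofReal (Real.sin (ε / 3) ^ 2) := by rw [hθ]; ring
      _ ≤ V.μt t (V.Aev t γ) * V.ν (V.Bev t γ) := mul_le_mul' h3 hB
  · -- not risky: the product event is `Eopt × univ`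
    have hA : V.Aev t γ = E := by ext ω; simp [Aev, hrisky, hEdef]
    have hB : V.Bev t γ = Set.univ := by ext r; simp [Bev, hrisky]
    rw [hA, hB, measure_univ, mul_one]
    calc ENNReal.ofReal (θ ε) * V.μt t E ≤ 1 * V.μt t E := by
          refine mul_le_mul' ?_ le_rfl
          rw [← ENNReal.ofReal_one]; exact ENNReal.ofReal_le_ofReal hθ1
      _ = V.μt t E := one_mul _

/-! ### Summation over `γ`: the inequality on `P_t ⊗ ν`, and on the sample space -/

/-- **GM14 (6.34) on `P_t ⊗ ν`**: `θ · P_t(h = ℓ) ≤ (P_t ⊗ ν)(h = ℓ, h' ≥ ℓ)`.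
[cite: GrimmettManolescu2014Isoradial, §6.3 (6.34)] -/
theorem theta_mul_le_prod_Bset {ε : ℝ} (hV : V.Valid ε) (hM : 4 * V.N + 4 ≤ V.M) {t : ℕ} (ht : t < V.N * V.N) :
    ENNReal.ofReal (θ ε) * V.μt t {ω | hRec (V.DomT t) V.N ω = V.ℓN t} ≤ ((V.μt t).prod V.ν) (V.Bset t) := by
  by_cases hℓ : V.ℓN t ≤ V.N
  swap
  · -- the record never exceeds `N`
    have : {ω : Set (Sym2 SV) | hRec (V.DomT t) V.N ω = V.ℓN t} = ∅ := by
      ext ω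
      simp only [Set.mem_setOf_eq, Set.mem_empty_iff_false, iff_false]
      intro h
      have := hRec_le (N := V.N) (reaches_zero (ω := ω) (V.zero_mem_DomT t))
      omega
    rw [this, measure_empty, mul_zero]; exact bot_le
  set q := V.weightsT t with hq
  have hS0 : ∃ m : ℤ, (m, (0 : ℤ)) ∈ V.DomT t := ⟨0, V.zero_mem_DomT t⟩
  -- `{h = ℓ}` is, up to a null set, the disjoint union of the `Eopt ℓ γ`
  have h1 : V.μt t {ω | hRec (V.DomT t) V.N ω = V.ℓN t} = V.μt t (⋃ γ : List SV, Eopt q (V.DomT t) V.N (V.ℓN t) γ) := by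
    rw [hq, weightsT, iUnion_Eopt hS0 hℓ, ← weightsT, ← hq]
    have : {ω : Set (Sym2 SV) | Clean q ω ∧ hRec (V.DomT t) V.N ω = V.ℓN t} = {ω | hRec (V.DomT t) V.N ω = V.ℓN t} ∩ {ω | Clean q ω} := by
      ext ω; simp only [Set.mem_setOf_eq, Set.mem_inter_iff]; tauto
    rw [this, μt, ← hq, prodBernoulli_inter_setOf_clean]
  have h2 : V.μt t (⋃ γ : List SV, Eopt q (V.DomT t) V.N (V.ℓN t) γ) = ∑' γ : List SV, V.μt t (Eopt q (V.DomT t) V.N (V.ℓN t) γ) := by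
    rw [hq, weightsT]
    exact measure_iUnion (disjoint_Eopt hS0 hℓ) fun γ => measurableSet_Eopt _ _ _ _ γ
  -- the disjoint union of the product events
  have h3 : ((V.μt t).prod V.ν) (⋃ γ : List SV, V.Aev t γ ×ˢ V.Bev t γ) = ∑' γ : List SV, V.μt t (V.Aev t γ) * V.ν (V.Bev t γ) := by
    rw [measure_iUnion (disjoint_Aev_prod_Bev t hℓ) fun γ => (measurableSet_Aev t γ).prod (measurableSet_Bev t γ)]
    congr 1; funext γ; exact Measure.prod_prod _ _
  have h4 : (⋃ γ : List SV, V.Aev t γ ×ˢ V.Bev t γ) ⊆ V.Bset t := Set.iUnion_subset fun γ => Aev_prod_Bev_subset hV hM ht hℓ γ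
  calc ENNReal.ofReal (θ ε) * V.μt t {ω | hRec (V.DomT t) V.N ω = V.ℓN t}
      = ∑' γ : List SV, ENNReal.ofReal (θ ε) * V.μt t (Eopt q (V.DomT t) V.N (V.ℓN t) γ) := by
        rw [h1, h2, ENNReal.tsum_mul_left]
    _ ≤ ∑' γ : List SV, V.μt t (V.Aev t γ) * V.ν (V.Bev t γ) :=
        ENNReal.tsum_le_tsum fun γ => theta_mul_le_Aev_prod_Bev hV hM ht hℓ γ
    _ = ((V.μt t).prod V.ν) (⋃ γ : List SV, V.Aev t γ ×ˢ V.Bev t γ) := h3.symm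
    _ ≤ ((V.μt t).prod V.ν) (V.Bset t) := measure_mono h4

/-- **GM14 (6.34) along the process**: for every exchange `t < N²` of level `ℓ`,
`θ(ε) · P(G t = ℓ) ≤ P(G t = ℓ ∧ G (t+1) ≥ ℓ)` — the survival hypothesis of the tail bound
`RandomMapChain.tailF_mul_le_measureReal`. [cite: GrimmettManolescu2014Isoradial, §6.3 (6.34)] -/
theorem theta_mul_measureReal_le {ε : ℝ} (hV : V.Valid ε) (hM : 4 * V.N + 4 ≤ V.M) {t : ℕ} (ht : t < V.N * V.N) :
    θ ε * V.P.real {x | V.G t x = V.ℓN t} ≤ V.P.real {x | V.G t x = V.ℓN t ∧ V.ℓN t ≤ V.G (t + 1) x} := by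
  obtain ⟨hθ0, -⟩ := θ_pos_le hV.ε_pos hV.ε_lt
  -- both events are preimages under `x ↦ (configuration before exchange `t`, randomness of exchange `t`)`
  set F : V.Ω → Set (Sym2 SV) × V.Noise := fun x => (V.cfgAt x t, x.2 ⟨t, ht⟩) with hF
  have hFm : Measurable F := (V.measurable_cfgAt t).prodMk ((measurable_pi_apply _).comp measurable_snd)
  have hA : {x : V.Ω | V.G t x = V.ℓN t} = F ⁻¹' ({ω | hRec (V.DomT t) V.N ω = V.ℓN t} ×ˢ Set.univ) := by
    ext x; simp [G, hF]
  have hB : {x : V.Ω | V.G t x = V.ℓN t ∧ V.ℓN t ≤ V.G (t + 1) x} = F ⁻¹' V.Bset t := by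
    ext x
    simp only [G, hF, Bset, Set.mem_setOf_eq, Set.mem_preimage]
    rw [V.cfgAt_succ x ht]
  have hAm : MeasurableSet ({ω : Set (Sym2 SV) | hRec (V.DomT t) V.N ω = V.ℓN t} ×ˢ (Set.univ : Set V.Noise)) :=
    (measurableSet_hRec_eq _ _ _).prod MeasurableSet.univ
  have key := theta_mul_le_prod_Bset hV hM ht
  have e1 : ((V.μt t).prod V.ν) (V.Bset t) = V.P {x | V.G t x = V.ℓN t ∧ V.ℓN t ≤ V.G (t + 1) x} := by
    rw [← V.map_cfgAt_prodMk hV ht, Measure.map_apply hFm (measurableSet_Bset t), ← hB]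
  have e2 : V.μt t {ω | hRec (V.DomT t) V.N ω = V.ℓN t} = V.P {x | V.G t x = V.ℓN t} := by
    have : V.μt t {ω | hRec (V.DomT t) V.N ω = V.ℓN t} =
        ((V.μt t).prod V.ν) ({ω | hRec (V.DomT t) V.N ω = V.ℓN t} ×ˢ (Set.univ : Set V.Noise)) := by
      rw [Measure.prod_prod, measure_univ, mul_one]
    rw [this, ← V.map_cfgAt_prodMk hV ht, Measure.map_apply hFm hAm, ← hA]
  rw [e1, e2] at key
  -- to real numbers
  have hfin : V.P {x | V.G t x = V.ℓN t ∧ V.ℓN t ≤ V.G (t + 1) x} ≠ ⊤ := measure_ne_top _ _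
  have := ENNReal.toReal_mono hfin key
  rw [ENNReal.toReal_mul, ENNReal.toReal_ofReal hθ0.le] at this
  exact this

end VData

end TrackExchange

end Literature.Probability.Percolation
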